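import Mathlib
import Summits.ResolutionOfSingularities.ResolutionOfSingularities.Theorems.WeightedInvariantLocalWeightedDropWildMonicSCleanDefs

/-!
# `WeightedInvariant.LocalWeightedDrop`, line `hasse-ridge-face-selection`, S3ρ sub-stub S3ρD `stub_wildMonicSurfaceDescent`:
# the INDEX-WISE secondary cleanness clause `SCleanAt` (Perlega §5.2.1 `(i)_b ∨ (ii)_b ∨ (iii)_b` at one index `b`)

Crux item stmt-ResolutionOfSingularities-8899 `LocalWeightedDrop` (route `ResolutionOfSingularities/WeightedInvariant`), engine of
the door `HypersurfaceCentreConstruction` stmt-ResolutionOfSingularities-19897.  [OURS · L1 W4.3, chain w43, res-L1-w43-stub-7 (second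
seat on S3ρ under res-type-083); item (C4d) of `L/res-L1-w43-stub-7/S3RHOD-ROADMAP.md`.  MODEL: S. Perlega, thesis Wien 2017 /
arXiv:2011.14443, Ch. 5 §2.1 Definition and §2.2 (the secondary `ord`-cleaning process runs through the indices `b`: «start with the
minimal index for which none of `(i)_b – (iii)_b` hold and successively raise it», Lemma 5.2.8).  Nothing here is a statement of
H. Hironaka's manuscript [claim: Hironaka2017, status: under-review]; OUR definitions.]

* `SCleanAt p E A b` — the clause of `IsSClean p E A` (…WildMonicSCleanDefs, p506586) at ONE index `b`, verbatim;
* `isSClean_iff_forall_sCleanAt` — `IsSClean p E A ↔ ∀ b, d!·b < δ + r₁ → SCleanAt p E A b` (by `Iff.rfl`);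
* `exists_min_not_sCleanAt` — a position that is not secondary clean has a LEAST unclean index in range (the index of the cleaning step).
-/

set_option linter.dupNamespace false -- mandated namespace of this single-conjunct summit

noncomputable section

namespace Summit.ResolutionOfSingularities.ResolutionOfSingularities.Theorems

namespace WildMonic

open MvPowerSeries MonicDescent

variable {k : Type} [Field k]

/-- THE SECONDARY CLEANNESS CLAUSE AT THE INDEX `b` (Perlega's `(i)_b ∨ (ii)_b ∨ (iii)_b`, `q = qOf p d`, `δ = dRes`, `s = sFlag`):
`(i)_b` some slot `d − q < i < d` has a monomial `x₁^a x₂^j`, `j ≤ (d−i)·b`, with reduced scaled point ON the `s`-line; `(ii)_b` every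
monomial of the row `b·q` of the slot `d − q` lies strictly ABOVE the `s`-line; `(iii)_b` the least `x₁`-exponent of that row is prime to `q`. -/
def SCleanAt (p : ℕ) {d : ℕ} (E : Finset (Fin 2)) (A : Fin d → MvPowerSeries (Fin 2) k) (b : ℕ) : Prop :=
  (∃ (i : Fin d) (e : Fin 2 →₀ ℕ), d - qOf p d < (i : ℕ) ∧ coeff e (A i) ≠ 0 ∧ e 1 ≤ (d - (i : ℕ)) * b ∧
      OnSLine (dRes E (newtonSet A)) (sFlag E (newtonSet A)) (redPt A E i e)) ∨
  (∀ (i : Fin d) (e : Fin 2 →₀ ℕ), (i : ℕ) = d - qOf p d → coeff e (A i) ≠ 0 → e 1 = b * qOf p d →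
      AboveSLine (dRes E (newtonSet A)) (sFlag E (newtonSet A)) (redPt A E i e)) ∨
  (∃ (i : Fin d) (a : ℕ), (i : ℕ) = d - qOf p d ∧ RowMin (A i) (b * qOf p d) a ∧ ¬ qOf p d ∣ a)

/-- `IsSClean` is `SCleanAt` at every index in range. -/
theorem isSClean_iff_forall_sCleanAt (p : ℕ) {d : ℕ} (E : Finset (Fin 2)) (A : Fin d → MvPowerSeries (Fin 2) k) :
    IsSClean p E A ↔ ∀ b : ℕ, d.factorial * b < dRes E (newtonSet A) + excExp E (newtonSet A) 1 → SCleanAt p E A b :=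
  Iff.rfl

/-- A position that is not secondary clean has a LEAST UNCLEAN INDEX `b` in range; all smaller indices are clean. -/
theorem exists_min_not_sCleanAt (p : ℕ) {d : ℕ} (E : Finset (Fin 2)) (A : Fin d → MvPowerSeries (Fin 2) k) (h : ¬ IsSClean p E A) :
    ∃ b : ℕ, d.factorial * b < dRes E (newtonSet A) + excExp E (newtonSet A) 1 ∧ ¬ SCleanAt p E A b ∧
      ∀ b' < b, SCleanAt p E A b' := by
  classical
  have hex : ∃ b : ℕ, d.factorial * b < dRes E (newtonSet A) + excExp E (newtonSet A) 1 ∧ ¬ SCleanAt p E A b := by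
    by_contra hne
    exact h fun b hb => by_contra fun hc => hne ⟨b, hb, hc⟩
  refine ⟨Nat.find hex, (Nat.find_spec hex).1, (Nat.find_spec hex).2, fun b' hb' => ?_⟩
  have hmin := Nat.find_min hex hb'
  by_contra hc
  exact hmin ⟨lt_of_le_of_lt (Nat.mul_le_mul_left _ hb'.le) (Nat.find_spec hex).1, hc⟩

end WildMonic

end Summit.ResolutionOfSingularities.ResolutionOfSingularities.Theorems

end
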